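import Summits.BirchSwinnertonDyer.BirchSwinnertonDyer.Theorems.ManinLocalTwoThreeHexagonalSqueezeTwentySeven
import Literature.NumberTheory.EllipticCurves.CongruentNumberCurveIsModular
import Literature.NumberTheory.EllipticCurves.AlgebraicModularParametrizationWithShift
import Literature.NumberTheory.EllipticCurves.PeriodLatticeRationalityProofs
import HarnessLib

/-!
# Level 32: `D.f = φ₃₂` for every `X₀(32)`-datum, and (S1)₃₂ `i·Λ(φ₃₂) ⊆ Λ(φ₃₂)` (cell bsd-f2-manin, -an g49 §94.8)

The level-`32` run of the §94 architecture (`N = 27`: `OmegaStableTwentySeven`, `HexagonalSqueezeTwentySeven`),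
planner file `HOME/an/g49/Sketch-an-g49c.lean` §1–§2 (ba17dc9aca9fc752) landed definition-free.  The CM order is
`ℤ[i]`, the shift is `t = (1 ¼; 0 1)` (it normalises `Γ₀(N)` for `16 ∣ N`), the newform is
`φ₃₂ = η(4τ)²η(8τ)²` (`cuspFormEtaProductThirtyTwo`).

* §1 `D.f = φ₃₂` for every `X₀(32)`-datum (FACT-FREE; `a₁(φ₃₂) = 1` from the `η`-asymptotics,
  `dim S₂(Γ₀(32)) = 1`), and `cuspFormEtaProductThirtyTwo = congruentCuspForm32` (Köhler's `η`-product is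
  Tunnell's `θ`-series).
* §2 (S1)₃₂ PROVED: `i·Λ(φ₃₂) ⊆ Λ(φ₃₂)` (`φ₃₂(τ + ¼) = i φ₃₂(τ)` by the `η` translation law; `tγt⁻¹ ∈ Γ₀(32)`).

No modularity binder, no CDT.  BSD is not proved by this.
-/

set_option autoImplicit false
set_option linter.dupNamespace false

noncomputable section

open scoped MatrixGroups ModularForm Topology Real
open Filter CongruenceSubgroup WeierstrassCurve Function Complex
open UpperHalfPlane hiding I
open Literature.NumberTheory.EllipticCurves Literature.NumberTheory.EllipticCurves.ModularForms
open Summit.BirchSwinnertonDyer.BirchSwinnertonDyer.Theorems.ManinLocalTwoThree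

namespace Summit.BirchSwinnertonDyer.BirchSwinnertonDyer.Theorems.ManinLocalTwoThree.GaussStableThirtyTwo

/-! ## §1 `D.f = φ₃₂` for every `X₀(32)`-datum (FACT-FREE) -/

/-- The exponent vector of `η(4τ)²η(8τ)²` as an `η`-quotient of level `32`. [cite: Koehler2011, §1] -/
theorem etaProductThirtyTwo_eq_etaQuotient (τ : ℍ) :
    etaProductThirtyTwo τ = etaQuotient 32 (fun δ ↦ if δ = 4 ∨ δ = 8 then 2 else 0) τ := by
  rw [etaProductThirtyTwo_apply, etaQuotient_apply, show Nat.divisors 32 = {1, 2, 4, 8, 16, 32} by decide]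
  simp [Finset.prod_insert, zpow_ofNat]

/-- `φ₃₂(τ)/q → 1` at `i∞` (order `(4·2 + 8·2)/24 = 1`, leading coefficient `1`). [cite: Koehler2011, §1] -/
theorem tendsto_etaProductThirtyTwo_div_qParam :
    Tendsto (fun τ : ℍ ↦ cuspFormEtaProductThirtyTwo τ / Periodic.qParam 1 (τ : ℂ)) atImInfty (𝓝 1) := by
  have h := tendsto_etaQuotient_div_qParam_zpow 32 (fun δ ↦ if δ = 4 ∨ δ = 8 then 2 else 0) 1
    (by rw [show Nat.divisors 32 = {1, 2, 4, 8, 16, 32} by decide]; simp [Finset.sum_insert])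
  refine h.congr fun τ ↦ ?_
  rw [zpow_one, ← etaProductThirtyTwo_eq_etaQuotient]
  rfl

/-- `a₁(φ₃₂) = 1`. [cite: CremonaAlgorithms1997, Table 3 (N = 32)] -/
theorem cuspCoeff_one_etaProductThirtyTwo : cuspCoeff cuspFormEtaProductThirtyTwo 1 = 1 :=
  NonVacuityTwentySeven.cuspCoeff_one_eq_of_tendsto _ tendsto_etaProductThirtyTwo_div_qParam

/-- `φ₃₂ = η(4τ)²η(8τ)²` is a newform of weight `2` on `Γ₀(32)` — FACT-FREE. [cite: Tunnell1983Congruent, p. 325] -/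
theorem isNewform0_etaProductThirtyTwo : IsNewform0 cuspFormEtaProductThirtyTwo :=
  ⟨Tunnell1983.mem_newSubspace0_thirtyTwo _,
    Tunnell1983.isHeckeEigenform_of_ne_zero_thirtyTwo cuspFormEtaProductThirtyTwo_ne_zero,
    cuspCoeff_one_etaProductThirtyTwo⟩

/-- The tree's `congruentCuspForm32` (Tunnell's `φ`) IS the `η`-product `η(4τ)²η(8τ)²`. [cite: Tunnell1983Congruent, p. 325] -/
theorem cuspFormEtaProductThirtyTwo_eq_congruentCuspForm32 :
    cuspFormEtaProductThirtyTwo = Tunnell1983.congruentCuspForm32 :=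
  Tunnell1983.eq_congruentCuspForm32_of_isNewform0 isNewform0_etaProductThirtyTwo

/-- **Every `X₀(32)`-datum of every curve has newform `φ₃₂`.** FACT-FREE. [cite: CremonaAlgorithms1997, Table 3 (N = 32)] -/
theorem f_eq_etaProductThirtyTwo {W : WeierstrassCurve ℚ} (D : ModularParametrizationData W 32) :
    D.f = cuspFormEtaProductThirtyTwo := by
  rw [Tunnell1983.eq_congruentCuspForm32_of_isNewform0 D.isNewformOf.1,
    cuspFormEtaProductThirtyTwo_eq_congruentCuspForm32]

/-! ## §2 (S1)₃₂ PROVED: `i·Λ(φ₃₂) ⊆ Λ(φ₃₂)` via the shift `t = (1 ¼; 0 1)` -/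

/-- `e^{2πi/24·2}·e^{2πi·2/24·2} = i`. [folklore] -/
theorem cexp_factor_eq_I :
    cexp (2 * π * I / 24) ^ 2 * cexp (2 * π * I * ((2 : ℤ) : ℂ) / 24) ^ 2 = I := by
  rw [← Complex.exp_nat_mul, ← Complex.exp_nat_mul, ← Complex.exp_add]
  have : ((2 : ℕ) : ℂ) * (2 * π * I / 24) + ((2 : ℕ) : ℂ) * (2 * π * I * ((2 : ℤ) : ℂ) / 24)
      = ((π / 2 : ℝ) : ℂ) * I := by push_cast; ring
  rw [this, Complex.exp_mul_I, ← Complex.ofReal_cos, ← Complex.ofReal_sin, Real.cos_pi_div_two,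
    Real.sin_pi_div_two]
  simp

/-- `φ₃₂(τ + ¼) = i φ₃₂(τ)` (`η(4τ + 1) = e^{2πi/24}η(4τ)`, `η(8τ + 2) = e^{4πi/24}η(8τ)`). [folklore] -/
theorem etaProductThirtyTwo_vadd_fourth (τ : ℍ) :
    etaProductThirtyTwo (((1 : ℝ) / 4 : ℝ) +ᵥ τ) = I * etaProductThirtyTwo τ := by
  rw [etaProductThirtyTwo_apply, etaProductThirtyTwo_apply]
  have h4 : (4 : ℂ) * (((((1 : ℝ) / 4 : ℝ) +ᵥ τ : ℍ)) : ℂ) = 4 * (τ : ℂ) + 1 := by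
    rw [coe_vadd]; push_cast; ring
  have h8 : (8 : ℂ) * (((((1 : ℝ) / 4 : ℝ) +ᵥ τ : ℍ)) : ℂ) = 8 * (τ : ℂ) + ((2 : ℤ) : ℂ) := by
    rw [coe_vadd]; push_cast; ring
  rw [h4, h8, eta_add_one, eta_add_intCast]
  calc (cexp (2 * π * I / 24) * η (4 * (τ : ℂ))) ^ 2
        * (cexp (2 * π * I * ((2 : ℤ) : ℂ) / 24) * η (8 * (τ : ℂ))) ^ 2
      = (cexp (2 * π * I / 24) ^ 2 * cexp (2 * π * I * ((2 : ℤ) : ℂ) / 24) ^ 2)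
          * (η (4 * (τ : ℂ)) ^ 2 * η (8 * (τ : ℂ)) ^ 2) := by ring
    _ = I * (η (4 * (τ : ℂ)) ^ 2 * η (8 * (τ : ℂ)) ^ 2) := by rw [cexp_factor_eq_I]

/-- **`ℰ_φ(τ + ¼) = i · ℰ_φ(τ)`** for `ℰ_φ = 2πi ∫_{i∞}^τ φ₃₂` (shift the vertical ray). [cite: Manin1972, §1.5] -/
theorem eichlerIntegral_vadd_oneFourth (τ : ℍ) :
    eichlerIntegral cuspFormEtaProductThirtyTwo (((1 : ℝ) / 4 : ℝ) +ᵥ τ) =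
      I * eichlerIntegral cuspFormEtaProductThirtyTwo τ := by
  unfold eichlerIntegral
  have hint : (∫ t in Set.Ioi (0 : ℝ),
        cuspFormEtaProductThirtyTwo (ofComplex ((((((1 : ℝ) / 4 : ℝ) +ᵥ τ : ℍ)) : ℂ) + t * Complex.I)))
      = I * ∫ t in Set.Ioi (0 : ℝ), cuspFormEtaProductThirtyTwo (ofComplex ((τ : ℂ) + t * Complex.I)) := by
    rw [← MeasureTheory.integral_const_mul]
    refine MeasureTheory.setIntegral_congr_fun measurableSet_Ioi fun s hs ↦ ?_
    have hs' : 0 < s := Set.mem_Ioi.mp hs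
    have h1 : 0 < ((τ : ℂ) + s * Complex.I).im := by simpa using add_pos τ.im_pos hs'
    have h2 : 0 < ((((((1 : ℝ) / 4 : ℝ) +ᵥ τ : ℍ)) : ℂ) + s * Complex.I).im := by
      simpa using add_pos ((((1 : ℝ) / 4 : ℝ)) +ᵥ τ).im_pos hs'
    rw [ofComplex_apply_of_im_pos h1, ofComplex_apply_of_im_pos h2]
    have hpt : (⟨_, h2⟩ : ℍ) = (((1 : ℝ) / 4 : ℝ)) +ᵥ (⟨(τ : ℂ) + s * Complex.I, h1⟩ : ℍ) := by
      apply UpperHalfPlane.ext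
      simp only [coe_vadd]
      ring
    rw [hpt, show (cuspFormEtaProductThirtyTwo : ℍ → ℂ) = etaProductThirtyTwo from rfl,
      etaProductThirtyTwo_vadd_fourth]
  rw [hint]
  ring

/-- **`t = (1 ¼; 0 1)` normalises `Γ₀(32)`**: for `γ ∈ Γ₀(32)` there is `γ′ ∈ Γ₀(32)` with
`γ′ • (τ + ¼) = γ • τ + ¼` (`γ′ = (a + c/4, b + (d − a)/4 − c/16; c, d − c/4)`, integral because `32 ∣ c`
and `a ≡ d (mod 4)`). [cite: Manin1972, Prop. 1.4] [cite: Shimura1971, Prop. 3.64] -/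
theorem exists_conj_oneFourth (γ : Gamma0 32) :
    ∃ γ' : Gamma0 32, ∀ τ : ℍ, ((γ' : SL(2, ℤ)) • ((((1 : ℝ) / 4 : ℝ)) +ᵥ τ) : ℍ) =
      (((1 : ℝ) / 4 : ℝ)) +ᵥ ((γ : SL(2, ℤ)) • τ) := by
  set a : ℤ := (γ : SL(2, ℤ)) 0 0 with ha
  set b : ℤ := (γ : SL(2, ℤ)) 0 1 with hb
  set c : ℤ := (γ : SL(2, ℤ)) 1 0 with hc
  set d : ℤ := (γ : SL(2, ℤ)) 1 1 with hd
  have hdet : a * d - b * c = 1 := by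
    have h := Matrix.det_fin_two ((γ : SL(2, ℤ)) : Matrix (Fin 2) (Fin 2) ℤ)
    rw [(γ : SL(2, ℤ)).det_coe] at h
    rw [ha, hb, hc, hd]; linarith
  have hc32 : (32 : ℤ) ∣ c := by
    have h := γ.2
    rw [Gamma0_mem] at h
    exact (ZMod.intCast_zmod_eq_zero_iff_dvd _ 32).mp h
  obtain ⟨k, hk⟩ := hc32
  have had : (4 : ℤ) ∣ d - a := by
    have key : ∀ a d : ZMod 4, a * d = 1 → d - a = 0 := by decide
    have h1 : ((a : ZMod 4)) * (d : ZMod 4) = 1 := by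
      have h := congrArg (fun z : ℤ ↦ (z : ZMod 4)) hdet
      rw [hk] at h
      push_cast at h
      have h32 : (32 : ZMod 4) = 0 := by decide
      simp only [h32, zero_mul, mul_zero, sub_zero] at h
      exact h
    have h2 := key _ _ h1
    have : (((d - a : ℤ)) : ZMod 4) = 0 := by push_cast; exact h2
    exact (ZMod.intCast_zmod_eq_zero_iff_dvd _ 4).mp this
  obtain ⟨m, hm⟩ := had
  let M : Matrix (Fin 2) (Fin 2) ℤ := !![a + 8 * k, b + m - 2 * k; 32 * k, d - 8 * k]
  have hMdet : M.det = 1 := by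
    rw [Matrix.det_fin_two_of]
    linear_combination hdet + b * hk + 8 * k * hm
  let γ'' : SL(2, ℤ) := ⟨M, hMdet⟩
  have hmem : γ'' ∈ Gamma0 32 := by
    rw [Gamma0_mem]
    exact (ZMod.intCast_zmod_eq_zero_iff_dvd _ 32).mpr ⟨k, rfl⟩
  refine ⟨⟨γ'', hmem⟩, fun τ ↦ ?_⟩
  have hcd : (![((32 * k : ℤ) : ℝ), ((d : ℤ) : ℝ)] : Fin 2 → ℝ) ≠ 0 := by
    intro h
    have h0 := congrFun h 0
    have h1 := congrFun h 1
    simp only [Matrix.cons_val_zero, Matrix.cons_val_one, Pi.zero_apply, Int.cast_eq_zero] at h0 h1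
    rw [hk, h0, h1] at hdet
    simp at hdet
  have hden := UpperHalfPlane.linear_ne_zero τ hcd
  simp only [Matrix.cons_val_zero, Matrix.cons_val_one, Complex.ofReal_intCast] at hden
  apply UpperHalfPlane.ext
  rw [UpperHalfPlane.coe_vadd, coe_specialLinearGroup_apply, coe_specialLinearGroup_apply]
  have e00 : ((((⟨γ'', hmem⟩ : Gamma0 32) : SL(2, ℤ)) 0 0 : ℤ)) = a + 8 * k := rfl
  have e01 : ((((⟨γ'', hmem⟩ : Gamma0 32) : SL(2, ℤ)) 0 1 : ℤ)) = b + m - 2 * k := rfl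
  have e10 : ((((⟨γ'', hmem⟩ : Gamma0 32) : SL(2, ℤ)) 1 0 : ℤ)) = 32 * k := rfl
  have e11 : ((((⟨γ'', hmem⟩ : Gamma0 32) : SL(2, ℤ)) 1 1 : ℤ)) = d - 8 * k := rfl
  rw [e00, e01, e10, e11, UpperHalfPlane.coe_vadd]
  simp only [← ha, ← hb, ← hc, ← hd, hk, eq_intCast, Complex.ofReal_intCast]
  have hm' : (d : ℂ) - (a : ℂ) = 4 * (m : ℂ) := by exact_mod_cast hm
  have hden_eq : (((32 * k : ℤ)) : ℂ) * (((((1 : ℝ) / 4 : ℝ)) : ℂ) + (τ : ℂ)) + ((d - 8 * k : ℤ) : ℂ)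
      = ((32 * k : ℤ) : ℂ) * (τ : ℂ) + (d : ℂ) := by
    push_cast; ring
  have hnum_eq : (((a + 8 * k : ℤ)) : ℂ) * (((((1 : ℝ) / 4 : ℝ)) : ℂ) + (τ : ℂ)) + ((b + m - 2 * k : ℤ) : ℂ) =
      ((a : ℂ) * (τ : ℂ) + (b : ℂ)) + (((32 * k : ℤ) : ℂ) * (τ : ℂ) + (d : ℂ)) / 4 := by
    push_cast
    linear_combination (-(1 : ℂ) / 4) * hm'
  rw [hden_eq, hnum_eq, add_div, add_comm]
  congr 1
  push_cast at hden ⊢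
  field_simp

/-- **`i · {∞, γ∞}_φ = {∞, γ′∞}_φ`** with `γ′ = tγt⁻¹ ∈ Γ₀(32)`. [cite: Manin1972, Prop. 1.4] -/
theorem I_mul_cuspSymbol_mem (γ : Gamma0 32) :
    I * cuspSymbol cuspFormEtaProductThirtyTwo γ ∈ periodLattice cuspFormEtaProductThirtyTwo := by
  obtain ⟨γ', hγ'⟩ := exists_conj_oneFourth γ
  have h := eichlerIntegral_smul_sub_holds cuspFormEtaProductThirtyTwo γ UpperHalfPlane.I
  have h' := eichlerIntegral_smul_sub_holds cuspFormEtaProductThirtyTwo γ' ((((1 : ℝ) / 4 : ℝ)) +ᵥ UpperHalfPlane.I)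
  rw [hγ' UpperHalfPlane.I, eichlerIntegral_vadd_oneFourth, eichlerIntegral_vadd_oneFourth, ← mul_sub, h] at h'
  rw [h']
  exact AddSubgroup.subset_closure ⟨γ', rfl⟩

/-- **(S1)₃₂ holds: the period lattice of `φ₃₂ = η(4τ)²η(8τ)²` is `ℤ[i]`-stable** (the CM of `X₀(32)`).
UNCONDITIONAL. [cite: Manin1972, Prop. 1.4 / §1.6] [cite: CremonaAlgorithms1997, §2.8] -/
theorem gaussStableThirtyTwo :
    ∀ z ∈ periodLattice cuspFormEtaProductThirtyTwo, I * z ∈ periodLattice cuspFormEtaProductThirtyTwo := by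
  intro z hz
  induction hz using AddSubgroup.closure_induction with
  | mem x hx =>
    obtain ⟨γ, rfl⟩ := hx
    exact I_mul_cuspSymbol_mem γ
  | zero => rw [mul_zero]; exact zero_mem _
  | add x y _ _ hx hy => rw [mul_add]; exact add_mem hx hy
  | neg x _ hx => rw [mul_neg]; exact neg_mem hx

end Summit.BirchSwinnertonDyer.BirchSwinnertonDyer.Theorems.ManinLocalTwoThree.GaussStableThirtyTwo

end
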